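import Summits.Ventures.HodgeRepro2.T5SU11ResolventTransformClass
import Summits.Ventures.HodgeRepro2.T5SU11ResolventNeumann

/-!
# The transform of the iterates of the resolvent, and the Neumann series in the transform picture

With the diagonalisation of row 520, `(G^I_λ g)^(λ′) = ĝ(λ′)/(μ′ − μ)`, and the stability of the class under the
resolvent (rows 499, 503):

* **`transform_iterate_eq`** — `((G^I_{λ₂})^n g)^(λ′) = ĝ(λ′)/(μ′ − μ₂)^n` for `1 < λ′ < λ₂` and a source at a rate
  `ε > λ′` (the iterates stay in the class at every rate below `min(ε, λ₂)`, in particular at one above `λ′`);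
* **`transform_comp_eq`** — `(G^I_λ(G^I_{λ₂} g))^(λ′) = ĝ(λ′)/((μ′ − μ)(μ′ − μ₂))` for `1 < λ′ < min(λ, λ₂)`: the
  multiplier of the composition is the product of the multipliers (row 488's statement, on the class);
* **`hasSum_transform_neumann`** — the Neumann series of row 507 in the transform picture:
  `Σ_k (μ − μ₂)^k ĝ(λ′)/(μ′ − μ₂)^{k+1} = ĝ(λ′)/(μ′ − μ)` for `|μ − μ₂| < |μ′ − μ₂|` — the geometric series
  `1/(μ′ − μ) = Σ_k (μ − μ₂)^k/(μ′ − μ₂)^{k+1}`, i.e. the transforms of the terms of the Neumann expansion sum to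
  the transform of the resolvent.

Nothing is claimed about (N).

Blind lane: Mathlib + the HodgeRepro2 prefix only; no sorry; axioms ⊆ {propext, Classical.choice,
Quot.sound}.
-/

namespace Summit.Ventures.HodgeRepro2.T5SU11ResolventTransformIterates

open Filter Topology MeasureTheory
open Set (Ioi Ioc)
open T5SU11Cartan T5SU11SphericalFunction T5SU11SphericalDecay T5SU11RadialGreenImproper
  T5SU11RadialGreenImproperStable T5SU11ResolventNeumann T5SU11ResolventTransformClass

section measure

variable [MeasurableSpace Circle] [BorelSpace Circle]

variable {lam lam₂ lam' : ℝ} (hlam : 1 < lam) (hlam₂ : 1 < lam₂) (h1 : 1 < lam')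
  {g : ℝ → ℝ} (hg : ContinuousOn g (Ioi 0))
  {M : ℝ} (hM : ∀ s ∈ Ioc (0 : ℝ) 1, |g s| ≤ M) (hM0 : 0 ≤ M)
  {ε C s₀ : ℝ} (hε : lam' < ε) (hC : ∀ s, s₀ ≤ s → |g s| ≤ C * Real.exp (-ε * s))

include hlam₂ h1 hg hM hM0 hε hC in
/-- **The transform of the iterates**: `((G^I_{λ₂})^n g)^(λ′) = ĝ(λ′)/(μ′ − μ₂)^n` for `1 < λ′ < λ₂`. -/
theorem transform_iterate_eq (h2 : lam' < lam₂) (n : ℕ) :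
    ∫ t in Ioi 0, (greenSolI (fun t => sph lam₂ (hyp t)) (sphDecay lam₂))^[n] g t * sph lam' (hyp t)
        * Real.sinh (2 * t)
      = (∫ s in Ioi 0, g s * sph lam' (hyp s) * Real.sinh (2 * s)) / (lam' * (lam' - 2) - lam₂ * (lam₂ - 2)) ^ n := by
  induction n with
  | zero => simp
  | succ n ih =>
    -- the `n`-th iterate is in the class at a rate `ε₁ ∈ (λ′, min(ε, λ₂))`
    have hε₂ : 2 - lam₂ < ε := by linarith
    obtain ⟨hcont, ⟨M', hM'0, hM'⟩, hdec⟩ := iterate_class hlam₂ hg hM hM0 hε₂ hC n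
    have hmin : lam' < min ε lam₂ := lt_min hε h2
    set ε₁ := (lam' + min ε lam₂) / 2 with hε₁
    have hε₁1 : lam' < ε₁ := by rw [hε₁]; linarith
    have hε₁2 : ε₁ < min ε lam₂ := by rw [hε₁]; linarith
    obtain ⟨K, T, hK, hT, hKT⟩ := hdec ε₁ hε₁2
    rw [Function.iterate_succ_apply', transform_greenSolI_eq hlam₂ h1 h2 hcont hM' hM'0 hε₁1 hKT, ih, pow_succ,
      div_div]

include hlam hlam₂ h1 hg hM hM0 hε hC in
/-- **The transform of the composition**: `(G^I_λ(G^I_{λ₂} g))^(λ′) = ĝ(λ′)/((μ′ − μ)(μ′ − μ₂))` for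
`1 < λ′ < min(λ, λ₂)`. -/
theorem transform_comp_eq (h2 : lam' < lam) (h2' : lam' < lam₂) :
    ∫ t in Ioi 0, greenSolI (fun t => sph lam (hyp t)) (sphDecay lam)
        (greenSolI (fun t => sph lam₂ (hyp t)) (sphDecay lam₂) g) t * sph lam' (hyp t) * Real.sinh (2 * t)
      = (∫ s in Ioi 0, g s * sph lam' (hyp s) * Real.sinh (2 * s))
          / ((lam' * (lam' - 2) - lam * (lam - 2)) * (lam' * (lam' - 2) - lam₂ * (lam₂ - 2))) := by
  have hε₂ : 2 - lam₂ < ε := by linarith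
  obtain ⟨hcont, ⟨M', hM'0, hM'⟩, hdec⟩ := iterate_class hlam₂ hg hM hM0 hε₂ hC 1
  have hmin : lam' < min ε lam₂ := lt_min hε h2'
  set ε₁ := (lam' + min ε lam₂) / 2 with hε₁
  have hε₁1 : lam' < ε₁ := by rw [hε₁]; linarith
  have hε₁2 : ε₁ < min ε lam₂ := by rw [hε₁]; linarith
  obtain ⟨K, T, hK, hT, hKT⟩ := hdec ε₁ hε₁2
  simp only [Function.iterate_one] at hcont hM' hKT
  rw [transform_greenSolI_eq hlam h1 h2 hcont hM' hM'0 hε₁1 hKT, transform_greenSolI_eq hlam₂ h1 h2' hg hM hM0 hε hC,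
    div_div, mul_comm]

omit [MeasurableSpace Circle] [BorelSpace Circle] in
/-- **The Neumann series in the transform picture**: for `|μ − μ₂| < |μ′ − μ₂|`,
`Σ_k (μ − μ₂)^k · a/(μ′ − μ₂)^{k+1} = a/(μ′ − μ)` — the transforms of the terms of row 507's expansion sum to the
transform of the resolvent. -/
theorem hasSum_transform_neumann {mu mu₂ mu' a : ℝ} (hq : |mu - mu₂| < |mu' - mu₂|) :
    HasSum (fun k : ℕ => (mu - mu₂) ^ k * (a / (mu' - mu₂) ^ (k + 1))) (a / (mu' - mu)) := by
  have hne : mu' - mu₂ ≠ 0 := by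
    intro h
    rw [h, abs_zero] at hq
    exact absurd hq (not_lt.mpr (abs_nonneg _))
  set r := (mu - mu₂) / (mu' - mu₂) with hr
  have hr1 : ‖r‖ < 1 := by
    rw [hr, Real.norm_eq_abs, abs_div, div_lt_one (abs_pos.mpr hne)]
    exact hq
  have hgeom : HasSum (fun k : ℕ => r ^ k) (1 - r)⁻¹ := hasSum_geometric_of_norm_lt_one hr1
  have h := hgeom.mul_left (a / (mu' - mu₂))
  have e1 : ∀ k : ℕ, a / (mu' - mu₂) * r ^ k = (mu - mu₂) ^ k * (a / (mu' - mu₂) ^ (k + 1)) := by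
    intro k
    rw [hr, div_pow, pow_succ]
    field_simp
  have hne' : mu' - mu ≠ 0 := by
    intro h0
    have : mu' = mu := by linarith
    rw [this] at hq
    exact absurd hq (lt_irrefl _)
  have e2 : a / (mu' - mu₂) * (1 - r)⁻¹ = a / (mu' - mu) := by
    have h1r : 1 - r = (mu' - mu) / (mu' - mu₂) := by
      rw [hr]
      field_simp
      ring
    rw [h1r, inv_div, div_mul_div_comm, mul_comm a (mu' - mu₂), mul_div_mul_left _ _ hne]
  rw [← e2]
  exact h.congr_fun (fun k => (e1 k).symm)

end measure

end Summit.Ventures.HodgeRepro2.T5SU11ResolventTransformIterates
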